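import Summits.BirchSwinnertonDyer.BirchSwinnertonDyer.Theorems.ManinLocalTwoThreePinningKernelFricke
import Summits.BirchSwinnertonDyer.BirchSwinnertonDyer.Theorems.ManinLocalTwoThreePinningKernelStaged
import Summits.BirchSwinnertonDyer.BirchSwinnertonDyer.Theorems.ManinLocalTwoThreePinningKernelCusp
import Summits.BirchSwinnertonDyer.BirchSwinnertonDyer.Theorems.ManinLocalTwoThreePinningTwoTwentyFourTablesC
import Literature.NumberTheory.EllipticCurves.ModularFormsGamma0WeightTwoDimension
import HarnessLib

/-!
# Level 224 (genus 25) by the PINNING KERNEL IN `S₂`: THE NEWFORM OF EVERY `X₀(224)`-DATUM IS `F_{224a, 224b}`, FACT-FREE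

Cell `bsd-f2-manin`, route `ManinLocalTwoThree`, crux C2 `ManinOddAtFour` (stmt-BirchSwinnertonDyer-22967), an g57 (LENS
analytic/periods); `--supports stmt-BirchSwinnertonDyer-22967` (helper).  INSTANCE of `…PinningKernel{Sieve,,Fricke,Staged,Cusp}`: the
level-144 template with the kernel run in the CUSP space (part G `…PinningKernelCusp`: `dim S₂(Γ₀(224)) = g = 25` instead of
`dim M₂ = 40`; at `ν_∞ = 16` cusps the Eisenstein part would double the basis and quadruple the sieve) and the script-emitted
data of level 224 (`an/g57/scripts/pk_data56.py 224 128` with `SPACE=S FIXN=7 OMIN=1 LOADENUM=cuspenum224.json`, `emit_level56.py 224 S`, `emit_levelfile56.py`);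
kernel certificates only, no level-specific algebra; the data and the table
certificates are parts 1–3 (`…PinningTwoTwentyFourTables`, `…TablesB`, `…TablesC`), this file is part 4 (duals, staged sieve, Fricke sieve, dimension, pinning).

THE RESULT.  `S₂(Γ₀(224))` (dimension `25 = g`) is spanned by 25 CUSPIDAL `η`-quotients (`Ls`, closed under the Fricke
reflection `σ`; strict Ligozat positivity `hcusp`), whose `M₂`-images `C₀,…` have certified tables to depth `128` and integer duals
(`d = 6720`).  The staged box sieve over the primes `2, 3, 5, 13, 7, 11, 17, 19, 23, 29, 31` with the certified column relations leaves
8 prime assignment(s) (`certs`); the Fricke sieve keeps `goodCerts` (Cremona `224a, 224b`; the others are old classes, killed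
for both signs by `decide`): **`pinning_cusp (D)`**: for some `(σ, d′, y) ∈ goodCerts`, `truth W = σ ∧ d′ • D.f = Σ_j y_j • S_j`
in `S₂(Γ₀(224))` `∧ d′ • D.f = Σ_j y_j • C_j` in `M₂(Γ₀(224))`, for every `X₀(224)`-datum `D` of any elliptic `W/ℚ`; **`pinning (D)`**:
the `M₂`-reading alone (same statement shape as the `M₂`-levels, so part F's row lemmas and the capstones apply verbatim).
HONEST FRAMING: unconditional, standard axioms; no newness/eigen statement about the combination is proved; the Néron/`c`-side
at `224` is NOT touched; nothing here proves C2/C3, Manin's conjecture or BSD.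
[cite: CremonaAlgorithms1997, §2.10, Table 1 (224a, 224b)] [cite: AtkinLehner1970, Thm. 3] [cite: Koehler2011, §2.1, §2.4]
[cite: Ligozat1975, Ch. 3] [cite: DiamondShurman2005, Thm. 3.5.1]
-/

set_option autoImplicit false
-- lint-debt: the directory name repeats the summit name (sibling precedent `ManinLocalTwoThreePinningSixtyThree.lean`)
set_option linter.dupNamespace false

noncomputable section


open Complex
open UpperHalfPlane hiding I
open scoped MatrixGroups ModularForm
open ModularForm CongruenceSubgroup
open Literature.NumberTheory.ModularForms
open Literature.NumberTheory.EllipticCurves Literature.NumberTheory.EllipticCurves.ModularForms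

namespace Summit.BirchSwinnertonDyer.BirchSwinnertonDyer.Theorems.ManinLocalTwoThree.PinningTwoTwentyFour

open Summit.BirchSwinnertonDyer.BirchSwinnertonDyer.Theorems.ManinLocalTwoThree.BracketSturm
open Summit.BirchSwinnertonDyer.BirchSwinnertonDyer.Theorems.ManinLocalTwoThree.PinningKernel


set_option maxHeartbeats 4000000
set_option maxRecDepth 16384

/-! ## §2d Duals, the staged sieve, the Fricke data -/

/-- **The dual certificate** `⟨dualsᵢ, tabsⱼ⟩ = 6720·δᵢⱼ`. [folklore] -/
theorem hdual : ∀ i j : Fin 25, dotList (duals i) (tabs j) = if i = j then (6720 : ℤ) else 0 := by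
  decide +kernel

/-- Sieve stage `0`: the live list `L_0` is mapped into `L_1` (kernel `decide`). [folklore] -/
theorem hst0 : ∀ σ ∈ sieveStep 224 128 ((([[]] : List (List (ℕ × ℤ))) :: lvs).getD 0 []) (stages.getD 0 (0, [])), σ ∈ lvs.getD 0 [] := by decide +kernel
/-- Sieve stage `1`: the live list `L_1` is mapped into `L_2` (kernel `decide`). [folklore] -/
theorem hst1 : ∀ σ ∈ sieveStep 224 128 ((([[]] : List (List (ℕ × ℤ))) :: lvs).getD 1 []) (stages.getD 1 (0, [])), σ ∈ lvs.getD 1 [] := by decide +kernel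
/-- Sieve stage `2`: the live list `L_2` is mapped into `L_3` (kernel `decide`). [folklore] -/
theorem hst2 : ∀ σ ∈ sieveStep 224 128 ((([[]] : List (List (ℕ × ℤ))) :: lvs).getD 2 []) (stages.getD 2 (0, [])), σ ∈ lvs.getD 2 [] := by decide +kernel
/-- Sieve stage `3`: the live list `L_3` is mapped into `L_4` (kernel `decide`). [folklore] -/
theorem hst3 : ∀ σ ∈ sieveStep 224 128 ((([[]] : List (List (ℕ × ℤ))) :: lvs).getD 3 []) (stages.getD 3 (0, [])), σ ∈ lvs.getD 3 [] := by decide +kernel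
/-- Stage 4 (`p = 7`, 6 live × box 11) is certified in 2 chunks. [folklore] -/
def chunks4 : List (List (List (ℕ × ℤ))) :=
  [[[(2, 0), (3, -2), (5, -4), (13, 0)], [(2, 0), (3, -2), (5, 0), (13, -4)], [(2, 0), (3, 0), (5, -2), (13, 6)], [(2, 0), (3, 0), (5, 2), (13, 2)], [(2, 0), (3, 2), (5, -4), (13, 0)]],
   [[(2, 0), (3, 2), (5, 0), (13, -4)]]]
/-- Sieve stage `4`, chunk `0` (kernel `decide`). [folklore] -/
theorem hst4c0 : ∀ σ ∈ sieveStep 224 128 (chunks4.getD 0 []) (stages.getD 4 (0, [])), σ ∈ lvs.getD 4 [] := by decide +kernel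
/-- Sieve stage `4`, chunk `1` (kernel `decide`). [folklore] -/
theorem hst4c1 : ∀ σ ∈ sieveStep 224 128 (chunks4.getD 1 []) (stages.getD 4 (0, [])), σ ∈ lvs.getD 4 [] := by decide +kernel
/-- Sieve stage `4`: the live list `L_4` is mapped into `L_5` (kernel `decide`). [folklore] -/
theorem hst4 : ∀ σ ∈ sieveStep 224 128 ((([[]] : List (List (ℕ × ℤ))) :: lvs).getD 4 []) (stages.getD 4 (0, [])), σ ∈ lvs.getD 4 [] :=
  sieveStep_subset_of_chunks 224 128 chunks4 (by decide +kernel) fun j hj ↦ by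
    have hj' : j < 2 := lt_of_lt_of_eq hj (by decide)
    interval_cases j
    exacts [hst4c0, hst4c1]
/-- Sieve stage `5`: the live list `L_5` is mapped into `L_6` (kernel `decide`). [folklore] -/
theorem hst5 : ∀ σ ∈ sieveStep 224 128 ((([[]] : List (List (ℕ × ℤ))) :: lvs).getD 5 []) (stages.getD 5 (0, [])), σ ∈ lvs.getD 5 [] := by decide +kernel
/-- Sieve stage `6`: the live list `L_6` is mapped into `L_7` (kernel `decide`). [folklore] -/
theorem hst6 : ∀ σ ∈ sieveStep 224 128 ((([[]] : List (List (ℕ × ℤ))) :: lvs).getD 6 []) (stages.getD 6 (0, [])), σ ∈ lvs.getD 6 [] := by decide +kernel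
/-- Sieve stage `7`: the live list `L_7` is mapped into `L_8` (kernel `decide`). [folklore] -/
theorem hst7 : ∀ σ ∈ sieveStep 224 128 ((([[]] : List (List (ℕ × ℤ))) :: lvs).getD 7 []) (stages.getD 7 (0, [])), σ ∈ lvs.getD 7 [] := by decide +kernel
/-- Sieve stage `8`: the live list `L_8` is mapped into `L_9` (kernel `decide`). [folklore] -/
theorem hst8 : ∀ σ ∈ sieveStep 224 128 ((([[]] : List (List (ℕ × ℤ))) :: lvs).getD 8 []) (stages.getD 8 (0, [])), σ ∈ lvs.getD 8 [] := by decide +kernel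
/-- Stage 9 (`p = 29`, 8 live × box 21) is certified in 2 chunks. [folklore] -/
def chunks9 : List (List (List (ℕ × ℤ))) :=
  [[[(2, 0), (3, -2), (5, -4), (13, 0), (7, -1), (11, 0), (17, -2), (19, 2), (23, -8)], [(2, 0), (3, -2), (5, 0), (13, -4), (7, -1), (11, -4), (17, -2), (19, -6), (23, 8)], [(2, 0), (3, -2), (5, 0), (13, -4), (7, 1), (11, 0), (17, 6), (19, 2), (23, 0)], [(2, 0), (3, 0), (5, 2), (13, 2), (7, -1), (11, -4), (17, -6), (19, 8), (23, 0)], [(2, 0), (3, 0), (5, 2), (13, 2), (7, 1), (11, 4), (17, -6), (19, -8), (23, 0)], [(2, 0), (3, 2), (5, -4), (13, 0), (7, 1), (11, 0), (17, -2), (19, -2), (23, 8)], [(2, 0), (3, 2), (5, 0), (13, -4), (7, -1), (11, 0), (17, 6), (19, -2), (23, 0)]],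
   [[(2, 0), (3, 2), (5, 0), (13, -4), (7, 1), (11, 4), (17, -2), (19, 6), (23, -8)]]]
/-- Sieve stage `9`, chunk `0` (kernel `decide`). [folklore] -/
theorem hst9c0 : ∀ σ ∈ sieveStep 224 128 (chunks9.getD 0 []) (stages.getD 9 (0, [])), σ ∈ lvs.getD 9 [] := by decide +kernel
/-- Sieve stage `9`, chunk `1` (kernel `decide`). [folklore] -/
theorem hst9c1 : ∀ σ ∈ sieveStep 224 128 (chunks9.getD 1 []) (stages.getD 9 (0, [])), σ ∈ lvs.getD 9 [] := by decide +kernel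
/-- Sieve stage `9`: the live list `L_9` is mapped into `L_10` (kernel `decide`). [folklore] -/
theorem hst9 : ∀ σ ∈ sieveStep 224 128 ((([[]] : List (List (ℕ × ℤ))) :: lvs).getD 9 []) (stages.getD 9 (0, [])), σ ∈ lvs.getD 9 [] :=
  sieveStep_subset_of_chunks 224 128 chunks9 (by decide +kernel) fun j hj ↦ by
    have hj' : j < 2 := lt_of_lt_of_eq hj (by decide)
    interval_cases j
    exacts [hst9c0, hst9c1]
/-- Stage 10 (`p = 31`, 8 live × box 23) is certified in 2 chunks. [folklore] -/
def chunks10 : List (List (List (ℕ × ℤ))) :=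
  [[[(2, 0), (3, -2), (5, -4), (13, 0), (7, -1), (11, 0), (17, -2), (19, 2), (23, -8), (29, 2)], [(2, 0), (3, -2), (5, 0), (13, -4), (7, -1), (11, -4), (17, -2), (19, -6), (23, 8), (29, 2)], [(2, 0), (3, -2), (5, 0), (13, -4), (7, 1), (11, 0), (17, 6), (19, 2), (23, 0), (29, -6)], [(2, 0), (3, 0), (5, 2), (13, 2), (7, -1), (11, -4), (17, -6), (19, 8), (23, 0), (29, 6)], [(2, 0), (3, 0), (5, 2), (13, 2), (7, 1), (11, 4), (17, -6), (19, -8), (23, 0), (29, 6)], [(2, 0), (3, 2), (5, -4), (13, 0), (7, 1), (11, 0), (17, -2), (19, -2), (23, 8), (29, 2)]],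
   [[(2, 0), (3, 2), (5, 0), (13, -4), (7, -1), (11, 0), (17, 6), (19, -2), (23, 0), (29, -6)], [(2, 0), (3, 2), (5, 0), (13, -4), (7, 1), (11, 4), (17, -2), (19, 6), (23, -8), (29, 2)]]]
/-- Sieve stage `10`, chunk `0` (kernel `decide`). [folklore] -/
theorem hst10c0 : ∀ σ ∈ sieveStep 224 128 (chunks10.getD 0 []) (stages.getD 10 (0, [])), σ ∈ lvs.getD 10 [] := by decide +kernel
/-- Sieve stage `10`, chunk `1` (kernel `decide`). [folklore] -/
theorem hst10c1 : ∀ σ ∈ sieveStep 224 128 (chunks10.getD 1 []) (stages.getD 10 (0, [])), σ ∈ lvs.getD 10 [] := by decide +kernel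
/-- Sieve stage `10`: the live list `L_10` is mapped into `L_11` (kernel `decide`). [folklore] -/
theorem hst10 : ∀ σ ∈ sieveStep 224 128 ((([[]] : List (List (ℕ × ℤ))) :: lvs).getD 10 []) (stages.getD 10 (0, [])), σ ∈ lvs.getD 10 [] :=
  sieveStep_subset_of_chunks 224 128 chunks10 (by decide +kernel) fun j hj ↦ by
    have hj' : j < 2 := lt_of_lt_of_eq hj (by decide)
    interval_cases j
    exacts [hst10c0, hst10c1]

/-- **THE SIEVE**, certified one stage at a time (`hst0 … hst10`: stage `k` maps the live list `L_k` into `L_{k+1}`),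
assembled by `PinningKernel.runSieve_subset_of_chain` (part D `…PinningKernelStaged`): the staged box sieve returns only assignments listed in `certs`.
[cite: CremonaAlgorithms1997, §2.10] -/
theorem hcover : ∀ σ ∈ runSieve 224 128 stages, σ ∈ certs.map Prod.fst := by
  have hch : ∀ k < stages.length, ∀ σ ∈ sieveStep 224 128 ((([[]] : List (List (ℕ × ℤ))) :: lvs).getD k [])
      (stages.getD k (0, [])), σ ∈ lvs.getD k [] := by
    intro k hk
    have hk' : k < 11 := lt_of_lt_of_eq hk (by decide)
    interval_cases k
    exacts [hst0, hst1, hst2, hst3, hst4, hst5, hst6, hst7, hst8, hst9, hst10]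
  have hlast : ((([[]] : List (List (ℕ × ℤ))) :: lvs).getD stages.length []) = certs.map Prod.fst := by decide +kernel
  exact fun σ hσ ↦ hlast ▸ runSieve_subset_of_chain 224 128 stages lvs (by decide) hch σ hσ

/-- **The coordinate certificates** `d'·aₙ(σ) = Σ_j y_j·tabsⱼ[n]` on the dual support. [folklore] -/
theorem hpiv : ∀ c ∈ certs, ∀ i : Fin 25, ∀ n < (duals i).length, (duals i).getD n 0 ≠ 0 →
    (evalOpt 224 c.1 n).map (fun x ↦ c.2.1 * x) = some (∑ j : Fin 25, c.2.2.getD (j : ℕ) 0 * (tabs j).getD n 0) := by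
  decide +kernel

/-- Every exponent row sums to `4` (weight `2`). [folklore] -/
theorem hsum : ∀ i : Fin 25, ∑ δ ∈ (224 : ℕ).divisors, expFn (Ls[(i : ℕ)]).1 δ = 4 := by
  decide +kernel

/-- The basis is `σ`-closed: `r_i(224/δ) = r_{σ i}(δ)` on the divisors. [cite: Koehler2011, §2.4] -/
theorem hsig : ∀ i : Fin 25, ∀ δ ∈ (224 : ℕ).divisors,
    EtaFricke.frickeExp 224 (expFn (Ls[(i : ℕ)]).1) δ = expFn (Ls[((sig i : Fin 25) : ℕ)]).1 δ := by
  decide +kernel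

/-- The Fricke constants: `knum² · ∏_{r>0} δ^r = 224² · kden² · ∏_{r<0} δ^{−r}`. [cite: Koehler2011, §2.4] -/
theorem hK : ∀ i : Fin 25, 0 < knum i ∧ 0 < kden i ∧
    knum i ^ 2 * posPart 224 (expFn (Ls[(i : ℕ)]).1) = 224 ^ 2 * kden i ^ 2 * negPart 224 (expFn (Ls[(i : ℕ)]).1) := by
  decide +kernel

/-! ## §3 `dim S₂(Γ₀(224)) = 25` -/

/-- `μ(Γ₀(224)) = 384`, `ν_∞ = 16`, `ν₂ = ν₃ = 0`. [cite: DiamondShurman2005, §3.8] -/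
theorem gamma0_data : gamma0Index 224 = 384 ∧ nuInfty 224 = 16 ∧ nu₂ 224 = 0 ∧ nu₃ 224 = 0 := by
  refine ⟨?_, by decide, by rw [nu₂_eq_card]; decide, by rw [nu₃_eq_card]; decide⟩
  · rw [(gamma0Index_mul (m := 32) (n := 7) (by norm_num)),
      show (32 : ℕ) = 2 ^ 5 by norm_num, gamma0Index_prime_pow (p := 2) (e := 5) Nat.prime_two (by norm_num),
      gamma0Index_prime (by norm_num : Nat.Prime 7)]
    norm_num

/-- **`dim S₂(Γ₀(224)) = 25`** (the genus; `μ = 384`, `ν_∞ = 16`), by the tree's `finrank_cuspForm_two_eq_genusX0_holds`.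
[cite: DiamondShurman2005, Thm. 3.5.1] -/
theorem finrank_cuspForm_two : Module.finrank ℂ (CuspForm (Gamma0 224) 2) = 25 := by
  obtain ⟨h1, h2, h3, h4⟩ := gamma0_data
  have h : Module.finrank ℂ (CuspForm (Gamma0 224) 2) = genusX0 224 := finrank_cuspForm_two_eq_genusX0_holds 224
  rw [h, genusX0, h1, h2, h3, h4]

/-! ## §4 The pinning (2 classes; kernel in `S₂`, read in `M₂` by part G `…PinningKernelCusp`) -/

/-- **LEVEL 224 PINNED IN `S₂(Γ₀(224))` (one of 2 newform classes).**  For every `X₀(224)`-datum of an elliptic `W/ℚ`, with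
the cuspidal `η`-quotients `Sᵢ` of `Ls` and their `M₂`-images `Cᵢ`: for some certificate `c = (σ, d', y) ∈ goodCerts` (Cremona
`224a, 224b`; the old classes are killed by the Fricke rows), the sieve truth of `W` is `σ`, `d' • D.f = Σ_j y_j • S_j` in `S₂(Γ₀(224))`
and `d' • f = Σ_j y_j • C_j` in `M₂(Γ₀(224))`. [cite: CremonaAlgorithms1997, §2.10, Table 1 (224a, 224b)] [cite: AtkinLehner1970, Thm. 3] -/
theorem pinning_cusp {W : WeierstrassCurve ℚ} [W.IsElliptic] (D : ModularParametrizationData W 224) :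
    ∃ S : Fin 25 → CuspForm (Gamma0 224) 2, ∃ C : Fin 25 → ModularForm (Gamma0 224) 2,
      (∀ i, ModularFormClass.modularForm (S i) = C i) ∧ (∀ i, ∀ τ : ℍ, C i τ = etaQuotient 224 (expFn (Ls[(i : ℕ)]).1) τ) ∧
      ∃ c ∈ goodCerts, truth W (stages.map Prod.fst) = c.1 ∧
        ((c.2.1 : ℤ) : ℂ) • D.f = ∑ j : Fin 25, ((c.2.2.getD (j : ℕ) 0 : ℤ) : ℂ) • S j ∧
        ((c.2.1 : ℤ) : ℂ) • ModularFormClass.modularForm D.f = ∑ j : Fin 25, ((c.2.2.getD (j : ℕ) 0 : ℤ) : ℂ) • C j := by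
  have hlen : ∀ i : Fin 25, (duals i).length ≤ 128 := by
    decide +kernel
  have hrel : ∀ st ∈ stages, ∀ v ∈ st.2, v.length ≤ 128 ∧ ∀ j : Fin 25, dotList v (tabs j) = 0 := by
    decide +kernel
  have hps : ∀ st ∈ stages, st.1.Prime := by
    intro st hst
    have h : st.1 ∈ stages.map Prod.fst := List.mem_map.mpr ⟨st, hst, rfl⟩
    have hl : stages.map Prod.fst = [2, 3, 5, 13, 7, 11, 17, 19, 23, 29, 31] := by decide
    rw [hl] at h
    simp only [List.mem_cons, List.mem_nil_iff, or_false] at h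
    rcases h with h | h | h | h | h | h | h | h | h | h | h <;> rw [h] <;> norm_num
  have hinj : Function.Injective sig := by
    decide
  have hfr : ∀ c ∈ certs, (frickeRowsOK sig knum kden 1 c.2.2 = true ∨ frickeRowsOK sig knum kden (-1) c.2.2 = true) → c ∈ goodCerts := by
    decide
  obtain ⟨S, hS⟩ := exists_etaCuspForms 224 Ls hcusp
  obtain ⟨C, hCS⟩ : ∃ C : Fin 25 → ModularForm (Gamma0 224) 2, ∀ i, ModularFormClass.modularForm (S i) = C i :=
    ⟨_, fun _ ↦ rfl⟩
  have hC : ∀ i, ∀ τ : ℍ, C i τ = etaQuotient 224 (expFn (Ls[(i : ℕ)]).1) τ := fun i τ ↦ by rw [← hCS]; exact hS i τ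
  have ht := tables_of_etaCertsSparse 224 128 (fun i : Fin 25 ↦ expFn (Ls[(i : ℕ)]).1) (fun i ↦ shifts i) tabs C hC hshift hcert
  obtain ⟨c, hc, hc1, hpinS, hpin⟩ := exists_smul_eq_sum_of_certs_cusp 224 D S C hCS tabs duals 6720 ht hlen hdual (by norm_num)
    finrank_cuspForm_two stages hps hrel certs hcover hpiv
  -- the Fricke sieve (part C), on the `M₂`-images
  have hli : LinearIndependent ℂ C := linearIndependent_of_dual C tabs duals 6720 ht hlen hdual (by norm_num)
  have hW := slash_eq_sum_frickePhi C (fun i : Fin 25 ↦ expFn (Ls[(i : ℕ)]).1) hC sig knum kden hsum hsig hK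
  have hd' : c.2.1 ≠ 0 := by
    simp only [certs, List.mem_cons, List.mem_nil_iff, or_false] at hc
    rcases hc with rfl | rfl | rfl | rfl | rfl | rfl | rfl | rfl <;> decide
  have hrows := frickeRows_of_pinning D C hli sig hinj knum kden (fun i ↦ (hK i).2.1) hW hd' c.2.2 hpin
  exact ⟨S, C, hCS, hC, c, hfr c hc hrows, hc1.symm, hpinS, hpin⟩

/-- **LEVEL 224 PINNED, `M₂`-READING** (the statement shape of the `M₂`-levels, consumed by part F's row lemmas and the
capstones): for some `(σ, d′, y) ∈ goodCerts`, `truth W = σ ∧ d′ • f = Σ_j y_j • C_j` in `M₂(Γ₀(224))`.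
[cite: CremonaAlgorithms1997, §2.10, Table 1 (224a, 224b)] [cite: AtkinLehner1970, Thm. 3] -/
theorem pinning {W : WeierstrassCurve ℚ} [W.IsElliptic] (D : ModularParametrizationData W 224) :
    ∃ C : Fin 25 → ModularForm (Gamma0 224) 2, (∀ i, ∀ τ : ℍ, C i τ = etaQuotient 224 (expFn (Ls[(i : ℕ)]).1) τ) ∧
      ∃ c ∈ goodCerts, truth W (stages.map Prod.fst) = c.1 ∧
        ((c.2.1 : ℤ) : ℂ) • ModularFormClass.modularForm D.f = ∑ j : Fin 25, ((c.2.2.getD (j : ℕ) 0 : ℤ) : ℂ) • C j := by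
  obtain ⟨S, C, -, hC, c, hc, h1, -, h2⟩ := pinning_cusp D
  exact ⟨C, hC, c, hc, h1, h2⟩

end Summit.BirchSwinnertonDyer.BirchSwinnertonDyer.Theorems.ManinLocalTwoThree.PinningTwoTwentyFour

end
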